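import Summits.ResolutionOfSingularities.ResolutionOfSingularities.Theorems.FrobeniusLadderFRationalResolutionClassOneFifth122ChartsA
import Summits.ResolutionOfSingularities.ResolutionOfSingularities.Theorems.FrobeniusLadderFRationalResolutionClassOneFifth122ChartsB
import Summits.ResolutionOfSingularities.ResolutionOfSingularities.Theorems.FrobeniusLadderFRationalResolutionClassZModWeights
import HarnessLib

/-!
# Crux `FrobeniusLadder.FRationalResolution` (stmt-ResolutionOfSingularities-15317), line `redirect`,
# stub `stub_diagonalizableQuotientResolution` — THE THREEFOLD CLASS `1/5(1,2,2)` (one point blow-up resolves)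

The weight kernel `P = {m ∈ ℕ³ : 5 ∣ m₀ + 2m₁ + 2m₂}` (the cyclic quotient threefold singularity `1/5(1,2,2)`, wild in characteristic `5`):
Hilbert basis of 12 (box check by `decide` on the `5³` box), 5 Newton vertices, exponent identities `2g = v + g'`, and all vertex charts free
(`…ClassOneFifth122ChartsA/B`) — so ONE point blow-up resolves.

* ★★★★ `hasResolution_of_isolated_fixedPoints_oneFifth122`, ★★★★ `…_zmod` (`A = ℤ/5`, `a = [1, 2, 2]`).

Honest label: a TOY instance of the class pipeline; no stub, crux or summit closed. No definitions, no named facts, no sorry.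
[folklore; cite: CoxLittleSchenck2011, §11.4] [cite: Kato1994, Thm. (3.2)]
-/

noncomputable section

-- single-problem summit: the doubled namespace component is forced
set_option linter.dupNamespace false

open CategoryTheory AlgebraicGeometry TopologicalSpace IsLocalRing
open Literature.AlgebraicGeometry.Resolution

namespace Summit.ResolutionOfSingularities.ResolutionOfSingularities.Theorems.FRationalResolution.ClassOneFifth122

open ConeCertificateGenerators

/-- The exponent of `p ∈ ℕⁿ` in `ℤⁿ`. -/
local notation3 (prettyPrint := false) "toZ[" n "]" =>
  (Finsupp.mapRange.addMonoidHom (Nat.castAddMonoidHom ℤ) : (Fin n →₀ ℕ) →+ (Fin n →₀ ℤ))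

/-- The Hilbert basis of `1/5(1,2,2)` (vertices first). -/
local notation3 (prettyPrint := false) "GG" => ({Finsupp.single 2 5, Finsupp.single 1 5, Finsupp.single 0 5, Finsupp.single 0 1 + Finsupp.single 2 2, Finsupp.single 0 1 + Finsupp.single 1 2, Finsupp.single 1 1 + Finsupp.single 2 4, Finsupp.single 1 4 + Finsupp.single 2 1, Finsupp.single 1 2 + Finsupp.single 2 3, Finsupp.single 1 3 + Finsupp.single 2 2, Finsupp.single 0 3 + Finsupp.single 2 1, Finsupp.single 0 3 + Finsupp.single 1 1, Finsupp.single 0 1 + Finsupp.single 1 1 + Finsupp.single 2 1} : Set (Fin 3 →₀ ℕ))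

/-- The weight kernel of `a = [1, 2, 2]` in `ℤ/5`. [folklore] -/
theorem weight_zmod_eq_zero_iff (a : Fin 3 → ZMod 5) (h0 : a 0 = ((1 : ℕ) : ZMod 5)) (h1 : a 1 = ((2 : ℕ) : ZMod 5)) (h2 : a 2 = ((2 : ℕ) : ZMod 5))
    (m : Fin 3 →₀ ℕ) : Finsupp.weight a m = 0 ↔ 5 ∣ m 0 + 2 * m 1 + 2 * m 2 := by
  rw [WeightKernelBasis.weight_eq_sum, Fin.sum_univ_three, h0, h1, h2, ← ZMod.natCast_eq_zero_iff]
  simp only [nsmul_eq_mul, Nat.cast_one, mul_one, Nat.cast_add, Nat.cast_mul]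
  constructor <;> intro h <;> simpa [mul_comm] using h

/-- ★★★★ **RESOLUTION OF VARIETIES WHOSE SINGULAR POINTS ARE ISOLATED FIXED POINTS OF TYPE `1/5(1,2,2)`** (threefold, any
characteristic): the point blow-up resolves. [folklore; cite: CoxLittleSchenck2011, §11.4] [cite: Kato1994, Thm. (3.2)] -/
theorem hasResolution_of_isolated_fixedPoints_oneFifth122 (k : Type) [Field k] (X : Scheme.{0}) [IsIntegral X]
    (f : X ⟶ Spec (.of k)) [LocallyOfFiniteType f] (hfin : (Scheme.regularLocus X)ᶜ.Finite)
    (hchart : ∀ t : X, t ∉ Scheme.regularLocus X →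
      ∃ (k' : Type) (_ : Field k') (A : Type) (_ : DecidableEq A) (_ : AddCommGroup A) (_ : AddMonoid.IsTorsion A)
        (S : Type) (_ : CommRing S) (_ : Algebra k' S) (𝒮 : A → Submodule k' S) (_ : GradedAlgebra 𝒮)
        (_ : Algebra.FiniteType k' S) (φ : Spec (.of (𝒮 0)) ⟶ X) (_ : Etale φ)
        (𝔔 : Ideal S) (_ : 𝔔.IsPrime) (_ : ∀ a : A, a ≠ 0 → ∀ s ∈ 𝒮 a, s ∈ 𝔔)
        (x : Fin 3 → S) (a : Fin 3 → A) (P : AddSubmonoid (Fin 3 →₀ ℕ))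
        (_ : ∀ i, x i ∈ 𝔔 ∧ x i ∈ 𝒮 (a i))
        (_ : Ideal.span (algebraMap S (Localization.AtPrime 𝔔) '' Set.range x) = maximalIdeal (Localization.AtPrime 𝔔))
        (_ : ((3 : ℕ) : WithBot ℕ∞) = ringKrullDim (Localization.AtPrime 𝔔))
        (_ : ∀ m, m ∈ P ↔ Finsupp.weight a m = 0)
        (_ : ∀ m : Fin 3 →₀ ℕ, m ∈ P ↔ 5 ∣ m 0 + 2 * m 1 + 2 * m 2),
        φ ⟨𝔔.comap (algebraMap (𝒮 0) S), inferInstance⟩ = t) :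
    Scheme.HasResolution X := by
  refine MonoidAlgebraLaurent.hasResolution_of_isolated_fixedPoints_of_mixedConeCertificate k X f hfin fun t ht => ?_
  have hc := hchart t ht
  obtain ⟨k', ik, A, iA₁, iA₂, hA, S, iS₁, iS₂, 𝒮, i𝒮, iS₃, φ, iφ, 𝔔, i𝔔, hfix, x, a, P, hxa, hspan, hn, hP, hcls, hφt⟩ := hc
  -- ### the Hilbert basis and its enumeration
  have hgP0 : (Finsupp.single 2 5 : Fin 3 →₀ ℕ) ∈ P := (hcls _).2 (by simp)
  have hgP1 : (Finsupp.single 1 5 : Fin 3 →₀ ℕ) ∈ P := (hcls _).2 (by simp)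
  have hgP2 : (Finsupp.single 0 5 : Fin 3 →₀ ℕ) ∈ P := (hcls _).2 (by simp)
  have hgP3 : (Finsupp.single 0 1 + Finsupp.single 2 2 : Fin 3 →₀ ℕ) ∈ P := (hcls _).2 (by simp)
  have hgP4 : (Finsupp.single 0 1 + Finsupp.single 1 2 : Fin 3 →₀ ℕ) ∈ P := (hcls _).2 (by simp)
  have hgP5 : (Finsupp.single 1 1 + Finsupp.single 2 4 : Fin 3 →₀ ℕ) ∈ P := (hcls _).2 (by simp)
  have hgP6 : (Finsupp.single 1 4 + Finsupp.single 2 1 : Fin 3 →₀ ℕ) ∈ P := (hcls _).2 (by simp)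
  have hgP7 : (Finsupp.single 1 2 + Finsupp.single 2 3 : Fin 3 →₀ ℕ) ∈ P := (hcls _).2 (by simp)
  have hgP8 : (Finsupp.single 1 3 + Finsupp.single 2 2 : Fin 3 →₀ ℕ) ∈ P := (hcls _).2 (by simp)
  have hgP9 : (Finsupp.single 0 3 + Finsupp.single 2 1 : Fin 3 →₀ ℕ) ∈ P := (hcls _).2 (by simp)
  have hgP10 : (Finsupp.single 0 3 + Finsupp.single 1 1 : Fin 3 →₀ ℕ) ∈ P := (hcls _).2 (by simp)
  have hgP11 : (Finsupp.single 0 1 + Finsupp.single 1 1 + Finsupp.single 2 1 : Fin 3 →₀ ℕ) ∈ P := (hcls _).2 (by simp)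
  have hGfin : (GG).Finite := (((((((((((Set.finite_singleton _).insert _).insert _).insert _).insert _).insert _).insert _).insert _).insert _).insert _).insert _).insert _
  have hGP' : GG ⊆ P := by
    rintro g (rfl | rfl | rfl | rfl | rfl | rfl | rfl | rfl | rfl | rfl | rfl | rfl)
    exacts [hgP0, hgP1, hgP2, hgP3, hgP4, hgP5, hgP6, hgP7, hgP8, hgP9, hgP10, hgP11]
  have hG0 : (0 : Fin 3 →₀ ℕ) ∉ GG := by
    rintro (h | h | h | h | h | h | h | h | h | h | h | h)
    · have := DFunLike.congr_fun h 2; simp at this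
    · have := DFunLike.congr_fun h 1; simp at this
    · have := DFunLike.congr_fun h 0; simp at this
    · have := DFunLike.congr_fun h 0; simp at this
    · have := DFunLike.congr_fun h 0; simp at this
    · have := DFunLike.congr_fun h 1; simp at this
    · have := DFunLike.congr_fun h 1; simp at this
    · have := DFunLike.congr_fun h 1; simp at this
    · have := DFunLike.congr_fun h 1; simp at this
    · have := DFunLike.congr_fun h 0; simp at this
    · have := DFunLike.congr_fun h 0; simp at this
    · have := DFunLike.congr_fun h 0; simp at this
  obtain ⟨gen, hgen0, hgen1, hgen2, hgen3, hgen4, hgen5, hgen6, hgen7, hgen8, hgen9, hgen10, hgen11⟩ : ∃ gen : Fin 12 → ↥P, ((gen 0 : ↥P) : Fin 3 →₀ ℕ) = (Finsupp.single 2 5 : Fin 3 →₀ ℕ) ∧ ((gen 1 : ↥P) : Fin 3 →₀ ℕ) = (Finsupp.single 1 5 : Fin 3 →₀ ℕ) ∧ ((gen 2 : ↥P) : Fin 3 →₀ ℕ) = (Finsupp.single 0 5 : Fin 3 →₀ ℕ) ∧ ((gen 3 : ↥P) : Fin 3 →₀ ℕ) = (Finsupp.single 0 1 + Finsupp.single 2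 2 : Fin 3 →₀ ℕ) ∧ ((gen 4 : ↥P) : Fin 3 →₀ ℕ) = (Finsupp.single 0 1 + Finsupp.single 1 2 : Fin 3 →₀ ℕ) ∧ ((gen 5 : ↥P) : Fin 3 →₀ ℕ) = (Finsupp.single 1 1 + Finsupp.single 2 4 : Fin 3 →₀ ℕ) ∧ ((gen 6 : ↥P) : Fin 3 →₀ ℕ) = (Finsupp.single 1 4 + Finsupp.single 2 1 : Fin 3 →₀ ℕ) ∧ ((gen 7 : ↥P) : Fin 3 →₀ ℕ) = (Finsupp.single 1 2 + Finsupp.single 2 3 : Fin 3 →₀ ℕ) ∧ ((gen 8 : ↥P) : Fin 3 →₀ ℕ) = (Finsupp.single 1 3 + Finsupp.single 2 2 : Fin 3 →₀ ℕ) ∧ ((gen 9 : ↥P) : Fin 3 →₀ ℕ) = (Finsupp.single 0 3 + Finsupp.single 2 1 : Fin 3 →₀ ℕ) ∧ ((gen 10 : ↥P) : Fin 3 →₀ ℕ) = (Finsupp.single 0 3 + Finsupp.single 1 1 : Fin 3 →₀ ℕ) ∧ ((gen 11 : ↥P) : Fin 3 →₀ ℕ) = (Finsupp.single 0 1 + Finsupp.single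 1 1 + Finsupp.single 2 1 : Fin 3 →₀ ℕ) :=
    ⟨![⟨(Finsupp.single 2 5 : Fin 3 →₀ ℕ), hgP0⟩, ⟨(Finsupp.single 1 5 : Fin 3 →₀ ℕ), hgP1⟩, ⟨(Finsupp.single 0 5 : Fin 3 →₀ ℕ), hgP2⟩, ⟨(Finsupp.single 0 1 + Finsupp.single 2 2 : Fin 3 →₀ ℕ), hgP3⟩, ⟨(Finsupp.single 0 1 + Finsupp.single 1 2 : Fin 3 →₀ ℕ), hgP4⟩, ⟨(Finsupp.single 1 1 + Finsupp.single 2 4 : Fin 3 →₀ ℕ), hgP5⟩, ⟨(Finsupp.single 1 4 + Finsupp.single 2 1 : Fin 3 →₀ ℕ), hgP6⟩, ⟨(Finsupp.single 1 2 + Finsupp.single 2 3 : Fin 3 →₀ ℕ), hgP7⟩, ⟨(Finsupp.single 1 3 + Finsupp.single 2 2 : Fin 3 →₀ ℕ), hgP8⟩, ⟨(Finsupp.single 0 3 + Finsupp.single 2 1 : Fin 3 →₀ ℕ), hgP9⟩, ⟨(Finsupp.single 0 3 + Finsupp.single 1 1 : Fin 3 →₀ ℕ), hgP10⟩, ⟨(Finsupp.single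 0 1 + Finsupp.single 1 1 + Finsupp.single 2 1 : Fin 3 →₀ ℕ), hgP11⟩], rfl, rfl, rfl, rfl, rfl, rfl, rfl, rfl, rfl, rfl, rfl, rfl⟩
  have hgenG : ∀ i, ((gen i : ↥P) : Fin 3 →₀ ℕ) ∈ GG := by
    intro i
    fin_cases i
    · exact Or.inl hgen0
    · exact Or.inr (Or.inl hgen1)
    · exact Or.inr (Or.inr (Or.inl hgen2))
    · exact Or.inr (Or.inr (Or.inr (Or.inl hgen3)))
    · exact Or.inr (Or.inr (Or.inr (Or.inr (Or.inl hgen4))))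
    · exact Or.inr (Or.inr (Or.inr (Or.inr (Or.inr (Or.inl hgen5)))))
    · exact Or.inr (Or.inr (Or.inr (Or.inr (Or.inr (Or.inr (Or.inl hgen6))))))
    · exact Or.inr (Or.inr (Or.inr (Or.inr (Or.inr (Or.inr (Or.inr (Or.inl hgen7)))))))
    · exact Or.inr (Or.inr (Or.inr (Or.inr (Or.inr (Or.inr (Or.inr (Or.inr (Or.inl hgen8))))))))
    · exact Or.inr (Or.inr (Or.inr (Or.inr (Or.inr (Or.inr (Or.inr (Or.inr (Or.inr (Or.inl hgen9)))))))))
    · exact Or.inr (Or.inr (Or.inr (Or.inr (Or.inr (Or.inr (Or.inr (Or.inr (Or.inr (Or.inr (Or.inl hgen10))))))))))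
    · exact Or.inr (Or.inr (Or.inr (Or.inr (Or.inr (Or.inr (Or.inr (Or.inr (Or.inr (Or.inr (Or.inr (hgen11)))))))))))
  have hGgen : ∀ g ∈ GG, ∃ i, ((gen i : ↥P) : Fin 3 →₀ ℕ) = g := by
    rintro g (rfl | rfl | rfl | rfl | rfl | rfl | rfl | rfl | rfl | rfl | rfl | rfl)
    exacts [⟨0, hgen0⟩, ⟨1, hgen1⟩, ⟨2, hgen2⟩, ⟨3, hgen3⟩, ⟨4, hgen4⟩, ⟨5, hgen5⟩, ⟨6, hgen6⟩, ⟨7, hgen7⟩, ⟨8, hgen8⟩, ⟨9, hgen9⟩, ⟨10, hgen10⟩, ⟨11, hgen11⟩]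
  have hgen0' : ∀ j, gen j ≠ 0 := by
    intro j h
    have h' : ((gen j : ↥P) : Fin 3 →₀ ℕ) = 0 := by rw [h]; rfl
    exact hG0 (h' ▸ hgenG j)
  have hT : ∀ (j : Fin 12) (i : Fin 3), ((gen j : ↥P) : Fin 3 →₀ ℕ) i = (![![0, 0, 5], ![0, 5, 0], ![5, 0, 0], ![1, 0, 2], ![1, 2, 0], ![0, 1, 4], ![0, 4, 1], ![0, 2, 3], ![0, 3, 2], ![3, 0, 1], ![3, 1, 0], ![1, 1, 1]] : Fin 12 → Fin 3 → ℕ) j i := by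
    intro j i
    fin_cases j <;> fin_cases i <;> simp [hgen0, hgen1, hgen2, hgen3, hgen4, hgen5, hgen6, hgen7, hgen8, hgen9, hgen10, hgen11]
  -- ### `⟨G⟩ = P` by the box check (the finite part by `decide`)
  have hGP : AddSubmonoid.closure GG = P := by
    refine WeightKernelBasis.closure_eq_of_box P GG hGP' ?_ 5 (by norm_num) ?_ ?_
    · intro m hm g hg hgm
      have hm' := (hcls m).1 hm
      have hg' := (hcls g).1 hg
      have h0 := Finsupp.le_def.1 hgm 0
      have h1 := Finsupp.le_def.1 hgm 1
      have h2 := Finsupp.le_def.1 hgm 2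
      refine (hcls _).2 ?_
      simp only [Finsupp.tsub_apply]
      omega
    · intro i
      fin_cases i
      · exact Or.inr (Or.inr (Or.inl rfl))
      · exact Or.inr (Or.inl rfl)
      · exact Or.inl rfl
    · intro m hm hm0 hlt
      have hm' := (hcls m).1 hm
      have key : ∀ x y z : Fin 5, ((x : ℕ) + 2 * (y : ℕ) + 2 * (z : ℕ)) % 5 = 0 → ((x : ℕ) ≠ 0 ∨ (y : ℕ) ≠ 0 ∨ (z : ℕ) ≠ 0) →
          ∃ j : Fin 12, ((![![0, 0, 5], ![0, 5, 0], ![5, 0, 0], ![1, 0, 2], ![1, 2, 0], ![0, 1, 4], ![0, 4, 1], ![0, 2, 3], ![0, 3, 2], ![3, 0, 1], ![3, 1, 0], ![1, 1, 1]] : Fin 12 → Fin 3 → ℕ) j 0 ≤ (x : ℕ) ∧ (![![0, 0, 5], ![0, 5, 0], ![5, 0, 0], ![1, 0, 2], ![1, 2, 0], ![0, 1, 4], ![0, 4, 1], ![0, 2, 3], ![0, 3, 2], ![3, 0, 1], ![3, 1, 0], ![1, 1, 1]] : Fin 12 → Fin 3 → ℕ) j 1 ≤ (y : ℕ)) ∧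 (![![0, 0, 5], ![0, 5, 0], ![5, 0, 0], ![1, 0, 2], ![1, 2, 0], ![0, 1, 4], ![0, 4, 1], ![0, 2, 3], ![0, 3, 2], ![3, 0, 1], ![3, 1, 0], ![1, 1, 1]] : Fin 12 → Fin 3 → ℕ) j 2 ≤ (z : ℕ) := by
        decide
      have hne : m 0 ≠ 0 ∨ m 1 ≠ 0 ∨ m 2 ≠ 0 := by
        by_contra h
        push Not at h
        exact hm0 (by ext i; fin_cases i <;> simp [h.1, h.2.1, h.2.2])
      obtain ⟨j, ⟨hj0, hj1⟩, hj2⟩ := key ⟨m 0, hlt 0⟩ ⟨m 1, hlt 1⟩ ⟨m 2, hlt 2⟩ (by simpa using (by omega : (m 0 + 2 * m 1 + 2 * m 2) % 5 = 0)) hne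
      refine ⟨(gen j : ↥P), hgenG j, fun h => hgen0' j (Subtype.ext (by rw [h]; rfl)), Finsupp.le_def.2 fun i => ?_⟩
      fin_cases i
      · rw [hT]; exact hj0
      · rw [hT]; exact hj1
      · rw [hT]; exact hj2
  -- ### the exponent identities `2 g = v + g'`
  have hid : ∀ i : Fin 12, (1 + 1) • gen i =
      (![gen 0, gen 1, gen 2, gen 3, gen 4] : Fin 5 → ↥P) ((![0, 1, 2, 3, 4, 0, 1, 0, 1, 2, 2, 3] : Fin 12 → Fin 5) i) + ∑ l : Fin 1,
      (![![gen 0], ![gen 1], ![gen 2], ![gen 3], ![gen 4], ![gen 7], ![gen 8], ![gen 6], ![gen 5], ![gen 3], ![gen 4], ![gen 4]] : Fin 12 → Fin 1 → ↥P) i l := by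
    intro i
    fin_cases i <;> apply Subtype.ext <;>
      simp [AddSubmonoidClass.coe_nsmul, AddSubmonoid.coe_add, hgen0, hgen1, hgen2, hgen3, hgen4, hgen5, hgen6, hgen7, hgen8, hgen9, hgen10, hgen11] <;>
      ext kk <;> fin_cases kk <;> simp
  refine ⟨k', ik, A, iA₁, iA₂, hA, S, iS₁, iS₂, 𝒮, i𝒮, iS₃, φ, iφ, 𝔔, i𝔔, hfix, 3, x, a, P, hxa, hspan, hn, hP, GG, hGfin, hG0, hGP,
    hφt, 12, gen, hgenG, hGgen, 5, ![gen 0, gen 1, gen 2, gen 3, gen 4], fun j => by fin_cases j <;> exact hgen0' _, 2, by norm_num,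
    ![0, 1, 2, 3, 4, 0, 1, 0, 1, 2, 2, 3], fun _ => 1, fun _ => by norm_num,
    ![![gen 0], ![gen 1], ![gen 2], ![gen 3], ![gen 4], ![gen 7], ![gen 8], ![gen 6], ![gen 5], ![gen 3], ![gen 4], ![gen 4]],
    fun i l => by fin_cases i <;> fin_cases l <;> exact hgen0' _, hid, fun j => ?_⟩
  -- ### the free vertex charts
  fin_cases j
  · exact chart_0 P hGP gen hgen0 hgen1 hgen2 hgen3 hgen4 hgen5 hgen6 hgen7 hgen8 hgen9 hgen10 hgen11 hgen0'
  · exact chart_1 P hGP gen hgen0 hgen1 hgen2 hgen3 hgen4 hgen5 hgen6 hgen7 hgen8 hgen9 hgen10 hgen11 hgen0'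
  · exact chart_2 P hGP gen hgen0 hgen1 hgen2 hgen3 hgen4 hgen5 hgen6 hgen7 hgen8 hgen9 hgen10 hgen11 hgen0'
  · exact chart_3 P hGP gen hgen0 hgen1 hgen2 hgen3 hgen4 hgen5 hgen6 hgen7 hgen8 hgen9 hgen10 hgen11 hgen0'
  · exact chart_4 P hGP gen hgen0 hgen1 hgen2 hgen3 hgen4 hgen5 hgen6 hgen7 hgen8 hgen9 hgen10 hgen11 hgen0'

/-- ★★★★ **`A = ℤ/5`, weights `[1, 2, 2]`**: the same with the single honest hypothesis. [folklore; cite: CoxLittleSchenck2011, §11.4] -/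
theorem hasResolution_of_isolated_fixedPoints_oneFifth122_zmod (k : Type) [Field k] (X : Scheme.{0}) [IsIntegral X]
    (f : X ⟶ Spec (.of k)) [LocallyOfFiniteType f] (hfin : (Scheme.regularLocus X)ᶜ.Finite)
    (hchart : ∀ t : X, t ∉ Scheme.regularLocus X →
      ∃ (k' : Type) (_ : Field k')
        (S : Type) (_ : CommRing S) (_ : Algebra k' S) (𝒮 : ZMod 5 → Submodule k' S) (_ : GradedAlgebra 𝒮)
        (_ : Algebra.FiniteType k' S) (φ : Spec (.of (𝒮 0)) ⟶ X) (_ : Etale φ)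
        (𝔔 : Ideal S) (_ : 𝔔.IsPrime) (_ : ∀ a : ZMod 5, a ≠ 0 → ∀ s ∈ 𝒮 a, s ∈ 𝔔)
        (x : Fin 3 → S) (P : AddSubmonoid (Fin 3 →₀ ℕ))
        (_ : ∀ i, x i ∈ 𝔔 ∧ x i ∈ 𝒮 (![((1 : ℕ) : ZMod 5), ((2 : ℕ) : ZMod 5), ((2 : ℕ) : ZMod 5)] i))
        (_ : Ideal.span (algebraMap S (Localization.AtPrime 𝔔) '' Set.range x) = maximalIdeal (Localization.AtPrime 𝔔))
        (_ : ((3 : ℕ) : WithBot ℕ∞) = ringKrullDim (Localization.AtPrime 𝔔))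
        (_ : ∀ m, m ∈ P ↔ Finsupp.weight (![((1 : ℕ) : ZMod 5), ((2 : ℕ) : ZMod 5), ((2 : ℕ) : ZMod 5)]) m = 0),
        φ ⟨𝔔.comap (algebraMap (𝒮 0) S), inferInstance⟩ = t) :
    Scheme.HasResolution X := by
  refine hasResolution_of_isolated_fixedPoints_oneFifth122 k X f hfin fun t ht => ?_
  have hc := hchart t ht
  obtain ⟨k', ik, S, iS₁, iS₂, 𝒮, i𝒮, iS₃, φ, iφ, 𝔔, i𝔔, hfix, x, P, hxa, hspan, hn, hP, hφt⟩ := hc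
  haveI : Fact (1 < 5) := ⟨by norm_num⟩
  exact ⟨k', ik, ZMod 5, inferInstance, inferInstance, is_add_torsion_of_finite (G := ZMod 5), S, iS₁, iS₂, 𝒮, i𝒮, iS₃, φ, iφ,
    𝔔, i𝔔, hfix, x, ![((1 : ℕ) : ZMod 5), ((2 : ℕ) : ZMod 5), ((2 : ℕ) : ZMod 5)], P, hxa, hspan, hn, hP,
    fun m => (hP m).trans (weight_zmod_eq_zero_iff _ rfl rfl rfl m), hφt⟩

end Summit.ResolutionOfSingularities.ResolutionOfSingularities.Theorems.FRationalResolution.ClassOneFifth122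

end
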